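import Mathlib.FieldTheory.AxGrothendieck
import Literature.NumberTheory.Automorphic.RootProductRetraction
import HarnessLib

/-!
# `U(y)` is the ordered product of its root subgroups: Springer 8.2.1 from 8.2.3 and 8.1.1 (i)
(trunk T-AUTOMORPHIC, G25 AutomorphicL)

Companion to `RootProductRetraction.lean` and `BigCellReduction.lean` (namespace
`Literature.Automorphic`). The named fact `posRootGroup_eq_prod` of `RootProductRetraction.lean` is the
surjectivity half of Springer, *Linear Algebraic Groups* (2nd ed.), 8.2.1: *for any numbering
`(α_i)_{i ∈ l}` of a system of positive roots `R⁺(y)`, every element of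
`U(y) = ⟨U_α : α ∈ R⁺(y)⟩` is an ordered product `∏_{i ∈ l} u_{α_i}(x_i)`*. This file **proves
it from two named facts already in the tree**, the commutator relations 8.2.3
(`rootSubgroup_commutator_le`, `RootSubgroupCommutators.lean`) and the uniqueness of root
subgroups 8.1.1 (i) (`rootSubgroup_unique`, `RootData.lean`):

* `listRootGroup u l = ⟨u_i(𝔾ₐ) : i ∈ l⟩` (definition by recursion on `l`) and its API;
  `posRootGroup_eq_listRootGroup`.
* `map_range_le_normalizer_listRootGroup` (proved from 8.2.3, 8.1.1 (i)): `U_{α_i}` normalises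
  `U_l` when `l` contains (the indices of) all roots `a α_i + c α_j`, `a, c > 0`, `j ∈ l`
  (`x v x⁻¹ = (x, v) v`).
* `posRootGroup_eq_prod_of_sorted` (proved): 8.2.1 (surjectivity) for a numbering sorted by
  non-decreasing height `⟨α, y⟩` — for a suffix `i :: l'`,
  `U_{i :: l'} = U_{α_i} ⊔ U_{l'} = U_{α_i} · U_{l'}` (Mathlib
  `Subgroup.coe_mul_of_left_le_normalizer_right`), the roots `a α_i + c α_j` having larger
  height than `α_i` (Springer 8.2.4, proof; Steinberg, *Lectures on Chevalley groups*, §3,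
  Lemma 17).
* `IsAlgebraicAddHom.det_eq_one` (proved): `det u(x) = 1` for an algebraic `u : 𝔾ₐ → GL_n`.
* `posRootGroup_eq_prod_of` (proved): **8.2.3 ∧ 8.1.1 (i) ⟹ `posRootGroup_eq_prod`** for every
  numbering `l`: the self-map `ψ = q⁰ ∘ φ_l` of `k^ι` (`φ_l(x) = ∏_{i ∈ l} u_i(x_i)`, `q⁰` the
  polynomial left inverse of the height-sorted product `φ_{l₀}`,
  `exists_polyRetraction_prod_rootHom`; identity outside `l`) is an injective polynomial map,
  hence surjective by the **Ax–Grothendieck theorem** (Mathlib `ax_grothendieck_univ`), so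
  `φ_l` maps onto `φ_{l₀}(k^m) = U(y)`. (Springer instead proves 8.2.1 for every numbering at
  once through Lie algebras and dimensions, 8.2.2.)
* `isAlgebraicSubgroup_posRootGroup` (proved, granted 8.2.3 and 8.1.1 (i)): `U(y)` is Zariski
  closed, being `{g ∈ G | φ_l(q(g)) = g}` (useful for the closedness of the Borel subgroups
  `B(y) = T · U(y)`, Springer 8.2.4 (i)).
* `Literature.NumberTheory.Automorphic.chevalley_isomorphism_of_structureFacts` (proved): `chevalley_isomorphism` follows
  from `chevalley_isomorphism_abstract` (9.6.2, step 1), `bigCell_nhds_one` (8.3.11),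
  `rootSubgroup_commutator_le` (8.2.3) and `rootSubgroup_unique` (8.1.1 (i)), the last three
  for `(G, T)` and for `(G', T')`.

Remaining DAG for `Literature.Lang.chevalley_isomorphism_holds`: `chevalley_isomorphism_abstract`,
`bigCell_nhds_one`, and the shared structure-theory leaves `rootSubgroup_commutator_le`,
`rootSubgroup_unique` (see `RootSubgroupProofs.lean` for the reduction of the latter to
Springer 7.6.4 (i), 7.1.4, 7.3.3 (ii)).

## References

* T. A. Springer, *Linear Algebraic Groups*, 2nd ed., Progress in Mathematics 9, Birkhäuser
  (1998) [SpringerLAG1998]: 8.1.1 (i), 8.2.1, 8.2.3, 8.2.4 (and its proof), 8.3.11, 9.6.2.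
* R. Steinberg, *Lectures on Chevalley groups*, Yale (1968), §3, Lemma 17.
* J. Ax, *The elementary theory of finite fields*, Ann. of Math. 88 (1968), 239–271 (§14).
-/

open scoped MatrixGroups IsMulCommutative Pointwise commutatorElement
open Matrix Polynomial MvPolynomial

noncomputable section

namespace Literature.NumberTheory.Automorphic

variable {k : Type*} [Field k] {n : Type*} [Fintype n] [DecidableEq n]
variable {ι X Y : Type*} [AddCommGroup X] [AddCommGroup Y]
variable {G T : Subgroup (GL n k)}

/-! ### The subgroup generated by a list of root homomorphisms -/

section ListGroup

/-- `U_l = ⟨u_i(𝔾ₐ) : i ∈ l⟩ ≤ GL n k`, defined by recursion on the list so that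
`U_{i :: l} = u_i(𝔾ₐ) ⊔ U_l` definitionally. [folklore] -/
def listRootGroup (u : ι → Multiplicative k →* ↥G) : List ι → Subgroup (GL n k)
  | [] => ⊥
  | i :: l => (u i).range.map G.subtype ⊔ listRootGroup u l

variable (u : ι → Multiplicative k →* ↥G)

/-- `U_[] = 1`. [folklore] -/
@[simp] theorem listRootGroup_nil : listRootGroup u [] = ⊥ := rfl

/-- `U_{i :: l} = u_i(𝔾ₐ) ⊔ U_l`. [folklore] -/
@[simp] theorem listRootGroup_cons (i : ι) (l : List ι) :
    listRootGroup u (i :: l) = (u i).range.map G.subtype ⊔ listRootGroup u l := rfl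

/-- `u_i(𝔾ₐ) ≤ U_l` for `i ∈ l`. [folklore] -/
theorem map_range_le_listRootGroup {i : ι} {l : List ι} (hi : i ∈ l) :
    (u i).range.map G.subtype ≤ listRootGroup u l := by
  induction l with
  | nil => simp at hi
  | cons j l ih =>
    rw [listRootGroup_cons]
    rcases List.mem_cons.mp hi with rfl | h
    · exact le_sup_left
    · exact (ih h).trans le_sup_right

/-- `U_l ≤ H` as soon as all `u_i(𝔾ₐ)`, `i ∈ l`, are. [folklore] -/
theorem listRootGroup_le {l : List ι} {H : Subgroup (GL n k)}
    (h : ∀ i ∈ l, (u i).range.map G.subtype ≤ H) : listRootGroup u l ≤ H := by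
  induction l with
  | nil => exact bot_le
  | cons j l ih =>
    rw [listRootGroup_cons]
    exact sup_le (h j (by simp)) (ih fun i hi => h i (by simp [hi]))

/-- Ordered products `∏_{i ∈ l} u_i(x_i)` lie in `U_l`. [folklore] -/
theorem prod_mem_listRootGroup (l : List ι) (x : ι → k) :
    (l.map fun i => ((u i (Multiplicative.ofAdd (x i)) : ↥G) : GL n k)).prod ∈
      listRootGroup u l := by
  induction l with
  | nil => simp
  | cons j l ih =>
    rw [List.map_cons, List.prod_cons, listRootGroup_cons]
    exact Subgroup.mul_mem _ (Subgroup.mem_sup_left ⟨u j _, ⟨_, rfl⟩, rfl⟩)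
      (Subgroup.mem_sup_right ih)

/-- `U(y) = U_l` for a numbering `l` of the `y`-positive roots. [folklore] -/
theorem posRootGroup_eq_listRootGroup (P : RootPairing ι ℤ X Y) (y : Y) {l : List ι}
    (hl' : ∀ i, i ∈ l ↔ 0 < P.root' i y) : posRootGroup G P u y = listRootGroup u l := by
  refine le_antisymm (iSup_le fun i => map_range_le_listRootGroup u ((hl' i.1).mpr i.2))
    (listRootGroup_le u fun i hi => ?_)
  exact le_iSup_of_le (f := fun i : {i : ι // 0 < P.root' i y} => (u i.1).range.map G.subtype)
    ⟨i, (hl' i).mp hi⟩ le_rfl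

end ListGroup

/-! ### Height-sorted numberings: `U(y) = ∏ U_α` from the commutator relations -/

section Sorted

variable [IsMulCommutative ↥T]
variable {P : RootPairing ι ℤ X Y} {eX : Additive ↥(characterLattice T) ≃+ X}
  {eY : Additive ↥(cocharacterLattice T) ≃+ Y}

/-- Granted 8.1.1 (i) (`rootSubgroup_unique`), the image of *any* root homomorphism `u_i` for
`α_i` is the root subgroup `U_{α_i}` (variant of `IsRootDatumOf.rootSubgroup_eq_map_range` of
`RootSubgroupCommutators.lean`, which is the case of the root homomorphism extracted from
`IsRootDatumOf.exists_sl2Hom`). [folklore] -/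
theorem map_range_eq_rootSubgroup [IsAlgClosed k] (h811 : rootSubgroup_unique (G := G) (T := T))
    (hG : IsConnectedReductive G) (hT : IsMaximalTorusIn T G) (h : IsRootDatumOf G T P eX eY)
    {u : ι → Multiplicative k →* ↥G}
    (hu : ∀ i, IsRootHom G T h.le (charOfWeight eX (P.root i)) (u i)) (i : ι) :
    (u i).range.map G.subtype = rootSubgroup G T (charOfWeight eX (P.root i)) := by
  obtain ⟨α, hα, hαi⟩ := h.exists_root_eq i
  rw [← hαi]
  exact h811 hG hT hα (u := u i) (by rw [hαi]; exact hu i)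

/-- **`u_i(𝔾ₐ)` normalises `U_{l}`** when, for every `j ∈ l`, all roots `a α_i + c α_j`
(`a, c > 0`) have their index in `l` and `α_j ≠ ±α_i`: by the commutator relations 8.2.3
(`rootSubgroup_commutator_le`), `x v x⁻¹ = (x, v) v ∈ U_l` for `x ∈ U_{α_i}`, `v ∈ U_{α_j}`.
[cite: SpringerLAG1998, 8.2.3 and 8.2.4 (proof)] -/
theorem map_range_le_normalizer_listRootGroup [IsAlgClosed k]
    (h823 : rootSubgroup_commutator_le (ι := ι) (X := X) (Y := Y) (G := G) (T := T))
    (h811 : rootSubgroup_unique (G := G) (T := T))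
    (hG : IsConnectedReductive G) (hT : IsMaximalTorusIn T G) (h : IsRootDatumOf G T P eX eY)
    {u : ι → Multiplicative k →* ↥G}
    (hu : ∀ i, IsRootHom G T h.le (charOfWeight eX (P.root i)) (u i)) (i : ι) (l : List ι)
    (hne : ∀ j ∈ l, P.root i ≠ P.root j ∧ P.root i ≠ -P.root j)
    (hcl : ∀ j ∈ l, ∀ (m : ι) (a c : ℕ), 0 < a → 0 < c →
      P.root m = a • P.root i + c • P.root j → m ∈ l) :
    (u i).range.map G.subtype ≤ Subgroup.normalizer (listRootGroup u l : Set (GL n k)) := by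
  -- conjugation by an element of `U_{α_i}` maps `U_l` into itself
  have key : ∀ x ∈ (u i).range.map G.subtype,
      (listRootGroup u l).map (MulAut.conj x).toMonoidHom ≤ listRootGroup u l := by
    intro x hx
    rw [Subgroup.map_le_iff_le_comap]
    refine listRootGroup_le u fun j hj => ?_
    rw [← Subgroup.map_le_iff_le_comap]
    rintro _ ⟨v, hv, rfl⟩
    simp only [MulEquiv.coe_toMonoidHom, MulAut.conj_apply]
    -- `x v x⁻¹ = ⁅x, v⁆ * v`
    have hxv : x * v * x⁻¹ = ⁅x, v⁆ * v := by
      rw [commutatorElement_def]; group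
    rw [hxv]
    refine Subgroup.mul_mem _ ?_ (map_range_le_listRootGroup u hj hv)
    -- the commutator lies in `⟨U_{aα_i + cα_j}⟩ ≤ U_l`
    have hcomm := h823 hG hT h i j (hne j hj).1 (hne j hj).2
    rw [← map_range_eq_rootSubgroup h811 hG hT h hu i,
      ← map_range_eq_rootSubgroup h811 hG hT h hu j] at hcomm
    refine (hcomm.trans ?_) (Subgroup.commutator_mem_commutator hx hv)
    refine iSup_le fun m => iSup_le fun hm => ?_
    obtain ⟨a, c, ha, hc, hmeq⟩ := hm
    rw [← map_range_eq_rootSubgroup h811 hG hT h hu m]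
    exact map_range_le_listRootGroup u (hcl j hj m a c ha hc hmeq)
  intro x hx
  refine mem_normalizer_of_map_conj_le (key x hx) (key x⁻¹ (Subgroup.inv_mem _ hx))

/-- **Springer 8.2.1 for a height-sorted numbering, from 8.2.3 and 8.1.1 (i).** Let `l` be a
numbering of the `y`-positive roots sorted by non-decreasing height `⟨α, y⟩`. Then every element
of `U(y)` is an ordered product `∏_{i ∈ l} u_i(x_i)`: for a suffix `i :: l'` of `l`,
`U_{i :: l'} = U_{α_i} ⊔ U_{l'} = U_{α_i} · U_{l'}` because `U_{α_i}` normalises `U_{l'}`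
(`map_range_le_normalizer_listRootGroup`: the roots `a α_i + c α_j`, `j ∈ l'`, have larger
height than `α_i`, hence lie in `l'`), and induction (Springer 8.2.4, proof; Steinberg,
*Lectures on Chevalley groups*, Lemma 17).
[cite: SpringerLAG1998, 8.2.1 with 8.2.3, 8.2.4 (proof)] -/
theorem posRootGroup_eq_prod_of_sorted [IsAlgClosed k]
    (h823 : rootSubgroup_commutator_le (ι := ι) (X := X) (Y := Y) (G := G) (T := T))
    (h811 : rootSubgroup_unique (G := G) (T := T))
    (hG : IsConnectedReductive G) (hT : IsMaximalTorusIn T G) (h : IsRootDatumOf G T P eX eY)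
    (u : ι → Multiplicative k →* ↥G)
    (hu : ∀ i, IsRootHom G T h.le (charOfWeight eX (P.root i)) (u i)) (y : Y) (l : List ι)
    (hl : l.Nodup) (hl' : ∀ i, i ∈ l ↔ 0 < P.root' i y)
    (hsort : l.Pairwise fun i j => P.root' i y ≤ P.root' j y) :
    ∀ g ∈ posRootGroup G P u y, ∃ x : ι → k,
      g = (l.map fun i => ((u i (Multiplicative.ofAdd (x i)) : ↥G) : GL n k)).prod := by
  classical
  rw [posRootGroup_eq_listRootGroup u P y hl']
  -- induction over the suffixes of `l`
  suffices key : ∀ (pre suf : List ι), l = pre ++ suf → ∀ g ∈ listRootGroup u suf, ∃ x : ι → k,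
      g = (suf.map fun i => ((u i (Multiplicative.ofAdd (x i)) : ↥G) : GL n k)).prod from
    key [] l rfl
  intro pre suf
  induction suf generalizing pre with
  | nil =>
    intro _ g hg
    rw [listRootGroup_nil, Subgroup.mem_bot] at hg
    exact ⟨0, by simp [hg]⟩
  | cons i suf ih =>
    intro hpre g hg
    -- facts about positions in the sorted list
    have hnd : (pre ++ i :: suf).Nodup := hpre ▸ hl
    have hisuf : i ∉ suf := (List.nodup_cons.mp (List.nodup_append.mp hnd).2.1).1
    have hsorted : (pre ++ i :: suf).Pairwise fun i j => P.root' i y ≤ P.root' j y := hpre ▸ hsort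
    have hpre_le : ∀ a ∈ pre, P.root' a y ≤ P.root' i y := fun a ha =>
      (List.pairwise_append.mp hsorted).2.2 a ha i (by simp)
    have hmem : ∀ j, j ∈ l ↔ j ∈ pre ∨ j = i ∨ j ∈ suf := fun j => by
      rw [hpre]; simp
    have hipos : 0 < P.root' i y := (hl' i).mp ((hmem i).mpr (Or.inr (Or.inl rfl)))
    -- `U_{α_i}` normalises `U_suf`
    have hnorm := map_range_le_normalizer_listRootGroup h823 h811 hG hT h hu i suf
      (fun j hj => by
        have hjpos : 0 < P.root' j y := (hl' j).mp ((hmem j).mpr (Or.inr (Or.inr hj)))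
        refine ⟨fun hij => hisuf ?_, fun hij => ?_⟩
        · rwa [P.root.injective hij] 
        · have := congrArg (fun x => P.toLinearMap x y) hij
          simp only [map_neg, LinearMap.neg_apply] at this
          change P.root' i y = -P.root' j y at this
          omega)
      (fun j hj m a c ha hc hmeq => by
        have hjpos : 0 < P.root' j y := (hl' j).mp ((hmem j).mpr (Or.inr (Or.inr hj)))
        have hm : P.root' m y = a * P.root' i y + c * P.root' j y := by
          have := congrArg (fun x => P.toLinearMap x y) hmeq
          simp only [map_add, map_nsmul, LinearMap.add_apply, LinearMap.smul_apply, nsmul_eq_mul]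
            at this
          exact this
        have ha1 : (1 : ℤ) ≤ a := by exact_mod_cast ha
        have hc1 : (1 : ℤ) ≤ c := by exact_mod_cast hc
        have hgt : P.root' i y < P.root' m y := by nlinarith
        have hmpos : 0 < P.root' m y := by omega
        rcases (hmem m).mp ((hl' m).mpr hmpos) with hm' | rfl | hm'
        · exact absurd (hpre_le m hm') (not_le.mpr hgt)
        · exact absurd hgt (lt_irrefl _)
        · exact hm')
    -- `U_{i :: suf} = U_{α_i} · U_suf`
    have hprod := Subgroup.coe_mul_of_left_le_normalizer_right _ _ hnorm
    rw [listRootGroup_cons] at hg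
    have hg' : (g : GL n k) ∈
        ((u i).range.map G.subtype : Set (GL n k)) * (listRootGroup u suf : Set (GL n k)) := by
      rw [← hprod]; exact hg
    obtain ⟨x₁, hx₁, g₂, hg₂, rfl⟩ := hg'
    obtain ⟨_, ⟨z, rfl⟩, rfl⟩ := hx₁
    obtain ⟨x, hx⟩ := ih (pre ++ [i]) (by rw [hpre]; simp) g₂ hg₂
    refine ⟨fun j => if j = i then Multiplicative.toAdd z else x j, ?_⟩
    have hmap : suf.map (fun j => ((u j (Multiplicative.ofAdd
        (if j = i then Multiplicative.toAdd z else x j)) : ↥G) : GL n k)) =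
        suf.map (fun j => ((u j (Multiplicative.ofAdd (x j)) : ↥G) : GL n k)) :=
      List.map_congr_left fun j hj => by
        have hji : j ≠ i := fun hji => hisuf (hji ▸ hj)
        rw [if_neg hji]
    show (G.subtype (u i z)) * g₂ = _
    rw [List.map_cons, List.prod_cons, hmap, ← hx]
    simp only [if_true, ofAdd_toAdd]
    rfl

end Sorted

/-! ### Any numbering: Springer 8.2.1 (surjectivity) via Ax–Grothendieck -/

section AnyOrder

/-- The determinant of an algebraic one-parameter subgroup `u : 𝔾ₐ → GL_n` is `1`: `det u(x)`
is a polynomial in `x` with `det u(x) · det u(-x) = 1`, hence a unit of `k[X]`, hence constant.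
(Cf. `IsAlgebraicAddHom.isUnipotentElt` of `UnipotentOneParameter.lean`: `u(x)` is even
unipotent; the present determinant statement is all that is needed here and has a two-line
proof.) [folklore] -/
theorem IsAlgebraicAddHom.det_eq_one [Infinite k] {u : Multiplicative k →* ↥G}
    (hu : IsAlgebraicAddHom u) (x : k) :
    Matrix.det (((u (Multiplicative.ofAdd x) : ↥G) : GL n k) : Matrix n n k) = 1 := by
  obtain ⟨Pu, hPu⟩ := hu
  set D : k[X] := Matrix.det (Matrix.of fun p q => Pu (Sum.inl (p, q))) with hD
  have hDeval : ∀ z : k, D.eval z =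
      Matrix.det (((u (Multiplicative.ofAdd z) : ↥G) : GL n k) : Matrix n n k) := by
    intro z
    rw [hD, ← Polynomial.coe_evalRingHom, RingHom.map_det]
    congr 1
    ext p q
    simp only [RingHom.mapMatrix_apply, Matrix.map_apply, Matrix.of_apply,
      Polynomial.coe_evalRingHom]
    rw [← hPu z (Sum.inl (p, q)), glCoordFun_inl]
  -- `D(z) D(-z) = 1`
  have hunit : D * D.comp (-Polynomial.X) = 1 := Polynomial.funext fun z => by
    rw [Polynomial.eval_mul, Polynomial.eval_comp, Polynomial.eval_neg, Polynomial.eval_X,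
      hDeval, hDeval, Polynomial.eval_one, ← Matrix.det_mul, ← Units.val_mul, ← Subgroup.coe_mul,
      ← map_mul, ← ofAdd_add, add_neg_cancel, ofAdd_zero, map_one, OneMemClass.coe_one,
      Units.val_one, Matrix.det_one]
  have hU : IsUnit D := IsUnit.of_mul_eq_one _ hunit
  have hC : D = Polynomial.C (D.coeff 0) :=
    Polynomial.eq_C_of_degree_eq_zero (Polynomial.degree_eq_zero_of_isUnit hU)
  have h0 : D.coeff 0 = 1 := by
    rw [Polynomial.coeff_zero_eq_eval_zero, hDeval]
    simp
  rw [← hDeval, hC, Polynomial.eval_C, h0]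

variable [IsMulCommutative ↥T]

/-- **Springer 8.2.1 (surjectivity, for every numbering) follows from 8.2.3 and 8.1.1 (i).**
Granted the commutator relations (`rootSubgroup_commutator_le`) and the uniqueness of root
subgroups (`rootSubgroup_unique`), every element of `U(y)` is an ordered product
`∏_{i ∈ l} u_i(x_i)` for *any* numbering `l` of `R⁺(y)` (`posRootGroup_eq_prod`). For a
height-sorted numbering `l₀` this is `posRootGroup_eq_prod_of_sorted`; for a general `l`,
the self-map `ψ = q⁰ ∘ φ_l` of `k^ι` (`q⁰` the polynomial left inverse of `φ_{l₀}`,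
`exists_polyRetraction_prod_rootHom`; identity on the coordinates outside `l`) is an injective
polynomial map, hence surjective by the Ax–Grothendieck theorem (Mathlib `ax_grothendieck_univ`),
which gives the surjectivity of `φ_l` onto `U(y) = φ_{l₀}(k^m)`.
[cite: SpringerLAG1998, 8.2.1 with 8.2.3 and 8.1.1 (i)] -/
theorem posRootGroup_eq_prod_of
    (h823 : rootSubgroup_commutator_le (ι := ι) (X := X) (Y := Y) (G := G) (T := T))
    (h811 : rootSubgroup_unique (G := G) (T := T)) :
    posRootGroup_eq_prod (k := k) (ι := ι) (X := X) (Y := Y) G T := by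
  intro _ _ hG hT P eX eY h u hu y hy l hl hl'
  classical
  haveI : Finite ι := h.finite_index hG hT
  -- a height-sorted renumbering `l₀`
  let r : ι → ι → Prop := fun i j => P.root' i y ≤ P.root' j y
  haveI : Std.Total r := ⟨fun i j => le_total _ _⟩
  haveI : IsTrans ι r := ⟨fun _ _ _ h1 h2 => le_trans h1 h2⟩
  set l₀ : List ι := l.insertionSort r with hl₀def
  have hperm : l₀.Perm l := List.perm_insertionSort r l
  have hl₀ : l₀.Nodup := hperm.nodup_iff.mpr hl
  have hl₀' : ∀ i, i ∈ l₀ ↔ 0 < P.root' i y := fun i => by rw [hperm.mem_iff]; exact hl' i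
  have hsort : l₀.Pairwise r := List.pairwise_insertionSort r l
  have hsurj₀ := posRootGroup_eq_prod_of_sorted h823 h811 hG hT h u hu y l₀ hl₀ hl₀' hsort
  -- polynomial left inverses for both numberings
  obtain ⟨q₀, hq₀⟩ := exists_polyRetraction_prod_rootHom hT.2.1 h u hu y l₀ hl₀
    fun i hi => (hl₀' i).mp hi
  obtain ⟨q, hq⟩ := exists_polyRetraction_prod_rootHom hT.2.1 h u hu y l hl
    fun i hi => (hl' i).mp hi
  -- the ordered product for `l`, a polynomial map
  set Φ : (ι → k) → GL n k := fun x =>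
    (l.map fun i => ((u i (Multiplicative.ofAdd (x i)) : ↥G) : GL n k)).prod with hΦ
  choose Pu hPu using fun i => (hu i).1
  set Pm : ι → n → n → k[X] := fun i p q => Pu i (Sum.inl (p, q)) with hPm
  have hΦmat : ∀ x, ((Φ x : GL n k) : Matrix n n k) = prodMat Pm l x := by
    intro x
    rw [hΦ, prodMat, ← Units.coeHom_apply, map_list_prod, List.map_map]
    congr 1
    refine List.map_congr_left fun i _ => ?_
    ext p q
    simp only [Function.comp_apply, Units.coeHom_apply, Matrix.of_apply, hPm]
    rw [← hPu i (x i) (Sum.inl (p, q)), glCoordFun_inl]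
  have hΦdet : ∀ x, Matrix.det ((Φ x : GL n k) : Matrix n n k) = 1 := by
    intro x
    rw [hΦ, ← Units.coeHom_apply, map_list_prod, ← Matrix.coe_detMonoidHom, map_list_prod,
      List.map_map, List.map_map]
    refine List.prod_eq_one fun d hd => ?_
    obtain ⟨i, _, rfl⟩ := List.mem_map.mp hd
    exact (hu i).1.det_eq_one (x i)
  -- the coordinates of `Φ x` as polynomials in `x`
  set σ : GLCoord n → MvPolynomial ι k :=
    Sum.elim (fun pq : n × n => prodPolyMat Pm l pq.1 pq.2) (fun _ => 1) with hσ
  have hσeval : ∀ x c, MvPolynomial.eval x (σ c) = glCoordFun (Φ x) c := by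
    intro x c
    rcases c with ⟨p, q⟩ | uu
    · rw [hσ, Sum.elim_inl, eval_prodPolyMat, ← hΦmat, glCoordFun_inl]
    · rw [hσ, Sum.elim_inr, map_one, glCoordFun_inr, hΦdet, inv_one]
  -- `Φ x ∈ U(y)`, and the canonical `l₀`-representation of the elements of `U(y)`
  have hΦmem : ∀ x, Φ x ∈ posRootGroup G P u y := fun x => by
    rw [posRootGroup_eq_listRootGroup u P y hl']
    exact prod_mem_listRootGroup u l x
  have hrepr : ∀ g ∈ posRootGroup G P u y,
      g = (l₀.map fun i => ((u i (Multiplicative.ofAdd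
        (MvPolynomial.eval (glCoordFun g) (q₀ i))) : ↥G) : GL n k)).prod := by
    intro g hg
    obtain ⟨z, rfl⟩ := hsurj₀ g hg
    congr 1
    exact List.map_congr_left fun i hi => by rw [hq₀ z i hi]
  -- the polynomial self-map `ψ` of `k^ι`
  set ps : ι → MvPolynomial ι k := fun i =>
    if i ∈ l then MvPolynomial.bind₁ σ (q₀ i) else MvPolynomial.X i with hps
  have hpsval : ∀ x i, MvPolynomial.eval x (ps i) =
      if i ∈ l then MvPolynomial.eval (glCoordFun (Φ x)) (q₀ i) else x i := by
    intro x i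
    simp only [hps]
    split_ifs with hi
    · rw [eval_bind₁]
      exact congrArg (fun f => MvPolynomial.eval f (q₀ i)) (funext (hσeval x))
    · rw [MvPolynomial.eval_X]
  have hinj : Function.Injective fun (v : ι → k) (i : ι) => MvPolynomial.eval v (ps i) := by
    intro x x' hxx'
    have hc : ∀ i, (if i ∈ l then MvPolynomial.eval (glCoordFun (Φ x)) (q₀ i) else x i) =
        (if i ∈ l then MvPolynomial.eval (glCoordFun (Φ x')) (q₀ i) else x' i) := fun i => by
      rw [← hpsval, ← hpsval]; exact congr_fun hxx' i
    have hΦeq : Φ x = Φ x' := by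
      rw [hrepr (Φ x) (hΦmem x), hrepr (Φ x') (hΦmem x')]
      congr 1
      refine List.map_congr_left fun i hi => ?_
      have hil : i ∈ l := hperm.mem_iff.mp hi
      have := hc i
      rw [if_pos hil, if_pos hil] at this
      rw [this]
    funext i
    by_cases hi : i ∈ l
    · rw [← hq x i hi, ← hq x' i hi]
      exact congrArg (fun g => MvPolynomial.eval (glCoordFun g) (q i)) hΦeq
    · have := hc i
      rwa [if_neg hi, if_neg hi] at this
  -- Ax–Grothendieck
  have hsurjψ := ax_grothendieck_univ ps hinj
  intro g hg
  obtain ⟨x, hx⟩ := hsurjψ fun i => if i ∈ l then MvPolynomial.eval (glCoordFun g) (q₀ i) else 0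
  refine ⟨x, ?_⟩
  have hx' : ∀ i ∈ l, MvPolynomial.eval (glCoordFun (Φ x)) (q₀ i) =
      MvPolynomial.eval (glCoordFun g) (q₀ i) := fun i hi => by
    have := congr_fun hx i
    simp only [hpsval, if_pos hi] at this
    exact this
  change g = Φ x
  rw [hrepr g hg, hrepr (Φ x) (hΦmem x)]
  congr 1
  exact List.map_congr_left fun i hi => by rw [hx' i (hperm.mem_iff.mp hi)]

end AnyOrder

/-! ### Consequence: `U(y)` is Zariski closed -/

section Closed

variable [IsMulCommutative ↥T]

/-- `U(y) ≤ G`. [folklore] -/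
theorem posRootGroup_le (P : RootPairing ι ℤ X Y) (u : ι → Multiplicative k →* ↥G) (y : Y) :
    posRootGroup G P u y ≤ G :=
  iSup_le fun _ => Subgroup.map_subtype_le _

/-- **`U(y)` is an algebraic subgroup** (Zariski closed in `GL_n`), granted 8.2.3 and 8.1.1 (i):
with a numbering `l` of `R⁺(y)` and the polynomial left inverse `q` of `φ_l`
(`exists_polyRetraction_prod_rootHom`), `U(y) = {g ∈ G | φ_l(q(g)) = g}` by the surjectivity
of `φ_l` (`posRootGroup_eq_prod_of`). (Springer 8.2.4, proof: the groups `U_n` are closed —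
there via 2.2.7 (i).) [cite: SpringerLAG1998, 8.2.1 and 8.2.4 (proof)] -/
theorem isAlgebraicSubgroup_posRootGroup [IsAlgClosed k] [CharZero k]
    (h823 : rootSubgroup_commutator_le (ι := ι) (X := X) (Y := Y) (G := G) (T := T))
    (h811 : rootSubgroup_unique (G := G) (T := T))
    (hG : IsConnectedReductive G) (hT : IsMaximalTorusIn T G)
    {P : RootPairing ι ℤ X Y} {eX : Additive ↥(characterLattice T) ≃+ X}
    {eY : Additive ↥(cocharacterLattice T) ≃+ Y} (h : IsRootDatumOf G T P eX eY)
    (u : ι → Multiplicative k →* ↥G)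
    (hu : ∀ i, IsRootHom G T h.le (charOfWeight eX (P.root i)) (u i))
    (y : Y) (hy : ∀ i, P.root' i y ≠ 0) :
    IsAlgebraicSubgroup (posRootGroup G P u y) := by
  classical
  haveI : Finite ι := h.finite_index hG hT
  haveI : Fintype ι := Fintype.ofFinite ι
  set l : List ι := (Finset.univ.filter fun i => 0 < P.root' i y).toList with hldef
  have hl : l.Nodup := Finset.nodup_toList _
  have hl' : ∀ i, i ∈ l ↔ 0 < P.root' i y := fun i => by simp [hldef]
  have hsurj := posRootGroup_eq_prod_of h823 h811 hG hT h u hu y hy l hl hl'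
  obtain ⟨q, hq⟩ := exists_polyRetraction_prod_rootHom hT.2.1 h u hu y l hl
    fun i hi => (hl' i).mp hi
  -- the product as a polynomial map
  set Φ : (ι → k) → GL n k := fun x =>
    (l.map fun i => ((u i (Multiplicative.ofAdd (x i)) : ↥G) : GL n k)).prod with hΦ
  choose Pu hPu using fun i => (hu i).1
  set Pm : ι → n → n → k[X] := fun i p q => Pu i (Sum.inl (p, q)) with hPm
  have hΦmat : ∀ x, ((Φ x : GL n k) : Matrix n n k) = prodMat Pm l x := by
    intro x
    rw [hΦ, prodMat, ← Units.coeHom_apply, map_list_prod, List.map_map]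
    congr 1
    refine List.map_congr_left fun i _ => ?_
    ext p q
    simp only [Function.comp_apply, Units.coeHom_apply, Matrix.of_apply, hPm]
    rw [← hPu i (x i) (Sum.inl (p, q)), glCoordFun_inl]
  -- the equations `φ_l(q(g))_{pq} = g_{pq}`
  obtain ⟨SG, hSG⟩ := hG.1.1
  set E : n × n → MvPolynomial (GLCoord n) k := fun pq =>
    MvPolynomial.bind₁ q (prodPolyMat Pm l pq.1 pq.2) - MvPolynomial.X (Sum.inl pq) with hE
  have hEeval : ∀ (g : GL n k) (pq : n × n), MvPolynomial.eval (glCoordFun g) (E pq) =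
      ((Φ fun i => MvPolynomial.eval (glCoordFun g) (q i) : GL n k) : Matrix n n k) pq.1 pq.2 -
        (g : Matrix n n k) pq.1 pq.2 := by
    intro g pq
    rw [hE, map_sub, MvPolynomial.eval_X, glCoordFun_inl, eval_bind₁, eval_prodPolyMat, hΦmat]
  refine ⟨SG ∪ Set.range E, Set.ext fun g => ⟨fun hg => ?_, fun hg => ?_⟩⟩
  · -- `U(y) ⊆ Z`
    have hgG : g ∈ (G : Set (GL n k)) := posRootGroup_le P u y hg
    rw [hSG] at hgG
    obtain ⟨x, hx⟩ := hsurj g hg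
    have hqx : ∀ i ∈ l, MvPolynomial.eval (glCoordFun g) (q i) = x i := fun i hi => by
      rw [hx]; exact hq x i hi
    have hΦg : (Φ fun i => MvPolynomial.eval (glCoordFun g) (q i)) = g := by
      have e1 : (l.map fun i => ((u i (Multiplicative.ofAdd
          (MvPolynomial.eval (glCoordFun g) (q i))) : ↥G) : GL n k)) =
          l.map fun i => ((u i (Multiplicative.ofAdd (x i)) : ↥G) : GL n k) :=
        List.map_congr_left fun i hi => by rw [hqx i hi]
      change (l.map _).prod = g
      rw [e1, ← hx]
    intro s hs
    rcases hs with hs | ⟨pq, rfl⟩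
    · exact hgG s hs
    · rw [hEeval, hΦg, sub_self]
  · -- `Z ⊆ U(y)`
    have hgG : g ∈ zeroLocusGL SG := fun s hs => hg s (Or.inl hs)
    have hent : ∀ pq : n × n,
        ((Φ fun i => MvPolynomial.eval (glCoordFun g) (q i) : GL n k) : Matrix n n k) pq.1 pq.2 =
          (g : Matrix n n k) pq.1 pq.2 := fun pq =>
      sub_eq_zero.mp (by rw [← hEeval]; exact hg _ (Or.inr ⟨pq, rfl⟩))
    have hgeq : g = Φ fun i => MvPolynomial.eval (glCoordFun g) (q i) :=
      Units.ext (Matrix.ext fun p q' => (hent (p, q')).symm)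
    rw [hgeq, hΦ, posRootGroup_eq_listRootGroup u P y hl']
    exact prod_mem_listRootGroup u l _

end Closed

end Literature.NumberTheory.Automorphic

/-! ### Consequence for Chevalley's isomorphism theorem -/

namespace Literature.NumberTheory.Automorphic


variable {k : Type*} [Field k]
variable {ι X Y : Type*} [AddCommGroup X] [AddCommGroup Y]
variable {N N' : ℕ} {G T : Subgroup (GL (Fin N) k)} {G' T' : Subgroup (GL (Fin N') k)}
  [IsMulCommutative ↥T] [IsMulCommutative ↥T']

/-- **`chevalley_isomorphism` from step 1 of Springer's proof of 9.6.2, the big cell 8.3.11, the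
commutator relations 8.2.3 and the uniqueness of root subgroups 8.1.1 (i).** Assembles
`chevalley_isomorphism_of_eq_prod` (`RootProductRetraction.lean`) with `posRootGroup_eq_prod_of`.
[cite: SpringerLAG1998, 9.6.2 (proof) with 8.1.1 (i), 8.2.1, 8.2.3 and 8.3.11] -/
theorem chevalley_isomorphism_of_structureFacts
    (hA : chevalley_isomorphism_abstract (k := k) (ι := ι) (X := X) (Y := Y) (G := G) (T := T)
      (G' := G') (T' := T'))
    (h823 : rootSubgroup_commutator_le (k := k) (ι := ι) (X := X) (Y := Y) (G := G) (T := T))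
    (h811 : rootSubgroup_unique (k := k) (G := G) (T := T))
    (hF2 : bigCell_nhds_one (k := k) (ι := ι) (X := X) (Y := Y) G T)
    (h823' : rootSubgroup_commutator_le (k := k) (ι := ι) (X := X) (Y := Y) (G := G') (T := T'))
    (h811' : rootSubgroup_unique (k := k) (G := G') (T := T'))
    (hF2' : bigCell_nhds_one (k := k) (ι := ι) (X := X) (Y := Y) G' T') :
    chevalley_isomorphism (k := k) (ι := ι) (X := X) (Y := Y) (G := G) (T := T) (G' := G')
      (T' := T') :=
  chevalley_isomorphism_of_eq_prod hA (posRootGroup_eq_prod_of h823 h811) hF2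
    (posRootGroup_eq_prod_of h823' h811') hF2'

end Literature.NumberTheory.Automorphic

end
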